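import Summits.BirchSwinnertonDyer.Rank1Residual.Additive.LegendreTwistRelationOfCharTwist
import Summits.BirchSwinnertonDyer.Rank1Residual.Additive.TameBranchOfSemistableTwistJoin
import Summits.BirchSwinnertonDyer.Rank1Residual.Additive.SemistableTwistAnalytic
import HarnessLib

/-!
# Class N10, defect 2: the tame branch of an additive curve at `p ≡ 1 (mod 4)` EXISTS
# UNCONDITIONALLY on (M) and (G-ord, `e = 2`) — the Legendre twist relation for the pair
# `(f_E, f_{E♭})` and the JOIN with the typed main conjecture
# (cell `b2b-bsdres`, lane CLASS-CLOSURE, seat cc-typer-2 GEN 3; curve-level corollaries of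
# `LegendreTwistRelationOfCharTwist.lean` + `TameBranchOfSemistableTwist(Join).lean`)

HONEST FRAMING (cell `b2b-bsdres`, run/shared/lean/b2b/bsd-rank1-residual/, verbatim in every
file): the goal of the cell is to DELETE the COMBINATION-SHAPED residual classes of the
Birch–Swinnerton-Dyer formula for ALL analytic-rank `≤ 1` elliptic curves over `ℚ` — "full BSD
formula for every rank `≤ 1` curve in class `C`" assembled STRICTLY from published theorems — so
that the rank-`≤ 1` remainder becomes exactly the CONSTRUCTION-SHAPED classes, which are TYPED
(missing-input `Prop`s), NOT attempted. This is not "finishing BSD". Lane CLASS-CLOSURE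
(coordinator ruling 2026-08-21T04:07Z): research routes, no claim beyond the stated classes;
census output = EVIDENCE / conjecture items with held-out validation, NEVER a Literature fact;
the class N10 stays CONSTRUCTION-shaped (RESIDUAL-MAP §I); NOTHING is booked. THEOREMS ONLY; no
definition, no named fact, no conjecture node; labels / RESIDUAL-MAP marks UNCHANGED.

## What and why

Let `E = W` be additive at a prime `p ≡ 1 (mod 4)` and `ℚ`-isomorphic to the twist by `p = p*` of a
curve `V = E♭` (`C • V^{(p)} = W`), with newforms `f = f_E ∈ S₂(Γ₀(N))`, `g = f_{E♭} ∈ S₂(Γ₀(N'))`.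
1. (§1, `exists_legendreTwistPlusRel_of_twist`) `aₙ(f) = (n/p)·aₙ(g)` for all `n` (the tree's
   coefficientwise twist identity `intCast_LFunction_eq_jacobiChar_mul_cuspCoeff`), so the PROVED
   even-branch relation `exists_legendreTwistPlusRel_of_cuspCoeff_eq` gives
   `∃ c ∈ ℚ, [s]⁺_f = c·∑_{u mod p}(u/p)[s + u/p]⁺_g` (`LegendreTwistPlusRel p f g c`) — the ONE typed
   comparison statement of `TameBranchOfSemistableTwist.lean` is now a THEOREM on this locus.
2. (§2) bookkeeping from the tree: `V` multiplicative ⇒ `a_p(V) = ±1`, `p ∣ N'`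
   (`IsNewformOf.cuspCoeff_eq_one_and_sq_of_split` / `…_neg_one_and_dvd_of_nonsplit`,
   `dvd_level_of_split`) and `W` is potentially multiplicative (`ord_p j(W) = ord_p j(V) < 0`).
3. (§3) hence the E-normalised tame branch `IsTameBranchOf f p (ι∘χ_p) α B` EXISTS (and is unique,
   `TameBranchUnique.lean`) with NO comparison hypothesis left: `α = unitRoot V p` when `V` is good
   ordinary at `p` (cell (G-ord, `e = 2`) seen from `E♭`), `α = a_p(V)` when `V` is multiplicative
   (cell (M)); coefficients bounded by any bound of `‖[·]⁺_f‖_p`.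
4. (§4, JOIN) feeding this `B` to the typed RATIONAL tame-branch main conjecture
   `TameBranchRatCharEqAt W p` (`TameBranchLower.lean`; the N10 missing input, NOT in print, an
   explicit binder): every Selmer dual datum of `E` over the cyclotomic `ℤ_p`-extension is
   `Λ`-torsion with characteristic power series `p^k·B(T)` — on (M) with no further hypothesis, on
   (G-ord) given the `W`-side typing `TypeGOrd W p`, `tameDefect W p = 2`.
So on the defect-2 part of N10 at `p ≡ 1 (mod 4)` the ONLY non-theorem input of the Λ-level
statement is `TameBranchRatCharEqAt` itself. The odd branch `p ≡ 3 (mod 4)` (minus symbols) is not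
treated (see `TameBranchOfSemistableTwistJoin.lean` §6 for its shape). Nothing booked; marks
unchanged.

References: Mazur–Tate–Teitelbaum, Invent. Math. 84 (1986) §I.8, §I.10–§I.11
[MazurTateTeitelbaum1986Invent]; Shimura 1971 Prop. 3.64 [Shimura1971]; Silverman AEC VII.5.1(b),
C.16 [SilvermanAEC2009].
-/

noncomputable section

open scoped Classical MatrixGroups ModularForm

open CongruenceSubgroup

namespace Summit.BirchSwinnertonDyer.Rank1Residual.Additive

open Literature.NumberTheory.EllipticCurves Literature.NumberTheory.EllipticCurves.ModularForms
  Literature.NumberTheory.EllipticCurves.Rank1Residual Literature.NumberTheory.QuadraticFields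
  WeierstrassCurve

/-! ### §1 The `q`-expansion twist and the Legendre twist relation at curve level -/

section QExp

variable {p : ℕ} [hp : Fact p.Prime] {N N' : ℕ} [NeZero N] [NeZero N']
  {f : CuspForm (Gamma0 N) 2} {g : CuspForm (Gamma0 N') 2}

/-- **`aₙ(f_E) = (n/p)·aₙ(f_{E♭})`** for `E = W ≅ V ⊗ χ_p` additive at `p ≡ 1 (mod 4)` (so `p* = p`),
`f` the newform of `W`, `g` the newform of `V` (tree `intCast_LFunction_eq_jacobiChar_mul_cuspCoeff`,
`jacobiChar p n = (n/p)`). [folklore] -/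
theorem cuspCoeff_eq_legendreSym_mul_cuspCoeff_of_twist (hp4 : p % 4 = 1)
    (V W : WeierstrassCurve ℚ) [V.IsElliptic] [W.IsElliptic]
    (hVW : ∃ C : VariableChange ℚ, C • V.quadraticTwist (p : ℚ) = W) (hadd : Addv W p)
    (hf : IsNewformOf W f) (hg : IsNewformOf V g) (n : ℕ) :
    cuspCoeff f n = (legendreSym p n : ℂ) * cuspCoeff g n := by
  haveI : NeZero p := ⟨hp.out.ne_zero⟩
  have h := intCast_LFunction_eq_jacobiChar_mul_cuspCoeff p hp4 V W hVW hadd hg n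
  rw [jacobiChar_natCast, ← jacobiSym.legendreSym.to_jacobiSym] at h
  rw [hf.2 n, h]

omit [NeZero N] [NeZero N'] in
/-- `p ≡ 1 (mod 4)` ⇒ `p ≠ 2` and `(−1/p) = 1` (Mathlib `legendreSym.at_neg_one`, `χ₄`). [folklore] -/
theorem ne_two_and_legendreSym_neg_one_of_mod_four_eq_one (hp4 : p % 4 = 1) :
    p ≠ 2 ∧ legendreSym p (-1) = 1 := by
  have hp2 : p ≠ 2 := by omega
  exact ⟨hp2, by rw [legendreSym.at_neg_one hp2, ZMod.χ₄_nat_one_mod_four hp4]⟩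

/-- **The Legendre twist relation of plus symbols for `(f_E, f_{E♭})`, PROVED** at `p ≡ 1 (mod 4)`:
for `E = W ≅ V ⊗ χ_p` additive at `p`, `f` the newform of `W` and `g` the newform of `V`, there is
`c ∈ ℚ` with `[s]⁺_f = c·∑_{u mod p}(u/p)[s + u/p]⁺_g` for all `s` — §1 and the even-branch theorem
`exists_legendreTwistPlusRel_of_cuspCoeff_eq` (`IsNewformOf ⇒ IsNewform0 ∧ coeffField = ℚ`). The
comparison statement of `TameBranchOfSemistableTwist.lean` is thereby discharged on this locus.
[cite: Shimura1971, Prop. 3.64] [cite: MazurTateTeitelbaum1986Invent, §I.8] -/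
theorem exists_legendreTwistPlusRel_of_twist (hp4 : p % 4 = 1)
    (V W : WeierstrassCurve ℚ) [V.IsElliptic] [W.IsElliptic]
    (hVW : ∃ C : VariableChange ℚ, C • V.quadraticTwist (p : ℚ) = W) (hadd : Addv W p)
    (hf : IsNewformOf W f) (hg : IsNewformOf V g) :
    ∃ c : ℚ, LegendreTwistPlusRel p f g c := by
  obtain ⟨hp2, heven⟩ := ne_two_and_legendreSym_neg_one_of_mod_four_eq_one (p := p) hp4
  exact exists_legendreTwistPlusRel_of_cuspCoeff_eq hp2 heven hf.1 hf.coeffField_eq_bot hg.1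
    hg.coeffField_eq_bot (cuspCoeff_eq_legendreSym_mul_cuspCoeff_of_twist hp4 V W hVW hadd hf hg)

/-- The same relation with `E♭` presented as the model `W^{(p*)}` (`p* = (−1)^{(p−1)/2} p`) and
`g` its newform (tree `cuspCoeff_eq_legendreSym_mul_cuspCoeff`, additive reduction at the place
over `p` from `Addv`, `hasAdditiveReductionAt_of_addv`). [cite: MazurTateTeitelbaum1986Invent, §I.8] -/
theorem exists_legendreTwistPlusRel_of_quadraticTwist_pStar (hp4 : p % 4 = 1)
    (W : WeierstrassCurve ℚ) [W.IsElliptic] (hadd : Addv W p) (hf : IsNewformOf W f)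
    (hg : IsNewformOf (W.quadraticTwist (((-1 : ℤ) ^ (p / 2) * p : ℤ) : ℚ)) g) :
    ∃ c : ℚ, LegendreTwistPlusRel p f g c := by
  obtain ⟨hp2, heven⟩ := ne_two_and_legendreSym_neg_one_of_mod_four_eq_one (p := p) hp4
  exact exists_legendreTwistPlusRel_of_cuspCoeff_eq hp2 heven hf.1 hf.coeffField_eq_bot hg.1
    hg.coeffField_eq_bot (W.cuspCoeff_eq_legendreSym_mul_cuspCoeff hp2
      (primesEquiv_symm_apply_coe p) (hasAdditiveReductionAt_of_addv W p hadd) hf hg)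

end QExp

/-! ### §2 Bookkeeping for the twist curve: `a_p(E♭) = ±1`, `p ∣ N'`, `E` potentially multiplicative -/

section Bookkeeping

variable {p : ℕ} [hp : Fact p.Prime] {N' : ℕ} [NeZero N'] {g : CuspForm (Gamma0 N') 2}

/-- At a MULTIPLICATIVE prime `p` of `V` with newform `g ∈ S₂(Γ₀(N'))`: `a_p(V) = ±1` and `p ∣ N'`
(split: `a_p = 1`, `IsNewformOf.cuspCoeff_eq_one_and_sq_of_split`, `dvd_level_of_split`; non-split:
`a_p = −1`, `…_neg_one_and_dvd_of_nonsplit`). [cite: SilvermanAEC2009, §C.16] -/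
theorem LFunction_eq_or_eq_neg_and_dvd_level_of_mult (V : WeierstrassCurve ℚ) (hV : Mult V p)
    (hg : IsNewformOf V g) :
    ((V.LFunction p : ℤ) = 1 ∨ (V.LFunction p : ℤ) = -1) ∧ p ∣ N' := by
  have hcoef : cuspCoeff g p = ((V.LFunction p : ℤ) : ℂ) := hg.2 p
  by_cases hs : V.HasSplitMultiplicativeReductionAtPrime p
  · obtain ⟨h1, -⟩ := hg.cuspCoeff_eq_one_and_sq_of_split hs
    refine ⟨Or.inl ?_, hg.dvd_level_of_split hs⟩
    have h : ((V.LFunction p : ℤ) : ℂ) = ((1 : ℤ) : ℂ) := by rw [← hcoef, h1, Int.cast_one]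
    exact_mod_cast h
  · obtain ⟨h1, hpN⟩ := hg.cuspCoeff_eq_neg_one_and_dvd_of_nonsplit hV hs
    refine ⟨Or.inr ?_, hpN⟩
    have h : ((V.LFunction p : ℤ) : ℂ) = ((-1 : ℤ) : ℂ) := by
      rw [← hcoef, h1, Int.cast_neg, Int.cast_one]
    exact_mod_cast h

/-- **A model of a quadratic twist of a curve multiplicative at `p` is potentially multiplicative at
`p`** (`PotMult W p : ord_p j(W) < 0`): `j(C • V^{(d)}) = j(V)` (`variableChange_j`,
`j_quadraticTwist`) and `ord_p j(V) < 0` at a multiplicative prime (Silverman AEC VII.5.1(b), tree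
`EisensteinPrimes.padicValRat_j_neg_of_mult`). [cite: SilvermanAEC2009, VII.5 Prop. 5.1(b)] -/
theorem potMult_of_twist_of_mult (V W : WeierstrassCurve ℚ) [V.IsElliptic] [W.IsElliptic]
    {d : ℚ} (hd : d ≠ 0) (hVW : ∃ C : VariableChange ℚ, C • V.quadraticTwist d = W)
    (hV : Mult V p) : PotMult W p := by
  obtain ⟨C, rfl⟩ := hVW
  haveI := V.isElliptic_quadraticTwist hd
  have hj : (C • V.quadraticTwist d).j = V.j := by rw [variableChange_j, V.j_quadraticTwist hd]
  show padicValRat p (C • V.quadraticTwist d).j < 0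
  rw [hj]
  exact EisensteinPrimes.padicValRat_j_neg_of_mult V p hV

end Bookkeeping

/-! ### §3 The tame branch EXISTS (and is unique) on (G-ord, `e = 2`) and (M) at `p ≡ 1 (mod 4)` -/

section Unconditional

variable {p : ℕ} [hp : Fact p.Prime] {N N' : ℕ} [NeZero N] [NeZero N']
  {f : CuspForm (Gamma0 N) 2} {g : CuspForm (Gamma0 N') 2}

/-- **(G-ord, `e = 2`) from `E♭`, UNCONDITIONAL: the E-normalised tame branch of `f_E` for `χ_p` and
THE unit root `α = unitRoot E♭ p` exists.** `E = W ≅ V ⊗ χ_p` additive at `p ≡ 1 (mod 4)`, `V`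
globally minimal GOOD ORDINARY at `p`, `f`, `g` the newforms of `W`, `V`: then
`∃ B, IsTameBranchOf f p (ι∘χ_p) (unitRoot V p) B`, with `‖b_n‖ ≤ C` for any bound `C` of
`‖[·]⁺_f‖_p` — `exists_isTameBranchOf_legendre_of_goodOrd` with its comparison hypothesis
DISCHARGED by `exists_legendreTwistPlusRel_of_twist`. [cite: MazurTateTeitelbaum1986Invent, §I.10 (10.1)–(10.2) and §I.11] -/
theorem exists_isTameBranchOf_of_goodOrd_twist (hp4 : p % 4 = 1)
    (V W : WeierstrassCurve ℚ) [V.IsElliptic] [V.IsGloballyMinimal] [W.IsElliptic]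
    (hVW : ∃ C : VariableChange ℚ, C • V.quadraticTwist (p : ℚ) = W) (hadd : Addv W p)
    (hord : GoodOrd V p) (hf : IsNewformOf W f) (hg : IsNewformOf V g) :
    ∃ B : PowerSeries ℚ_[p],
      IsTameBranchOf f p ((legendreChar p).ringHomComp (algebraMap ℚ_[p] ℂ_[p]))
        (unitRoot V p : ℚ_[p]) B ∧
      ∀ C : ℝ, (∀ r : ℚ, ‖((ratPlusSymbol f r : ℚ) : ℚ_[p])‖ ≤ C) →
        ∀ n : ℕ, ‖PowerSeries.coeff n B‖ ≤ C := by
  have hp2 : p ≠ 2 := (ne_two_and_legendreSym_neg_one_of_mod_four_eq_one (p := p) hp4).1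
  obtain ⟨c, hrel⟩ := exists_legendreTwistPlusRel_of_twist hp4 V W hVW hadd hf hg
  exact exists_isTameBranchOf_legendre_of_goodOrd V hp2 ((isOrdinaryAt_iff V p).mpr hord) hg hrel

/-- **(G-ord, `e = 2`): `∃!`** — the branch of `exists_isTameBranchOf_of_goodOrd_twist` is THE tame
branch for `(f_E, χ_p, unitRoot E♭ p)` (`IsTameBranchOf.unique`). [cite: MazurTateTeitelbaum1986Invent, §I.11 and §I.14 (14.3)] -/
theorem existsUnique_isTameBranchOf_of_goodOrd_twist (hp4 : p % 4 = 1)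
    (V W : WeierstrassCurve ℚ) [V.IsElliptic] [V.IsGloballyMinimal] [W.IsElliptic]
    (hVW : ∃ C : VariableChange ℚ, C • V.quadraticTwist (p : ℚ) = W) (hadd : Addv W p)
    (hord : GoodOrd V p) (hf : IsNewformOf W f) (hg : IsNewformOf V g) :
    ∃! B : PowerSeries ℚ_[p],
      IsTameBranchOf f p ((legendreChar p).ringHomComp (algebraMap ℚ_[p] ℂ_[p]))
        (unitRoot V p : ℚ_[p]) B := by
  obtain ⟨B, hB, -⟩ := exists_isTameBranchOf_of_goodOrd_twist hp4 V W hVW hadd hord hf hg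
  exact ⟨B, hB, fun B' hB' ↦ hB'.unique hB⟩

/-- **(M) from `E♭`, UNCONDITIONAL: the E-normalised tame branch of `f_E` for `χ_p` and
`α = a_p(E♭) = ±1` exists.** `E = W ≅ V ⊗ χ_p` additive at `p ≡ 1 (mod 4)`, `V` MULTIPLICATIVE at `p`,
`f`, `g` the newforms of `W`, `V`: then `∃ B, IsTameBranchOf f p (ι∘χ_p) (a_p(V)) B` with the same
coefficient bound — `exists_isTameBranchOf_legendre_of_mult` (`a_p(V) = ±1`, `p ∣ N'` by §2) with its
comparison hypothesis DISCHARGED. [cite: MazurTateTeitelbaum1986Invent, §I.10 (10.1) with ε(p) = 0] -/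
theorem exists_isTameBranchOf_of_mult_twist (hp4 : p % 4 = 1)
    (V W : WeierstrassCurve ℚ) [V.IsElliptic] [W.IsElliptic]
    (hVW : ∃ C : VariableChange ℚ, C • V.quadraticTwist (p : ℚ) = W) (hadd : Addv W p)
    (hV : Mult V p) (hf : IsNewformOf W f) (hg : IsNewformOf V g) :
    ∃ B : PowerSeries ℚ_[p],
      IsTameBranchOf f p ((legendreChar p).ringHomComp (algebraMap ℚ_[p] ℂ_[p]))
        (((V.LFunction p : ℤ)) : ℚ_[p]) B ∧
      ∀ C : ℝ, (∀ r : ℚ, ‖((ratPlusSymbol f r : ℚ) : ℚ_[p])‖ ≤ C) →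
        ∀ n : ℕ, ‖PowerSeries.coeff n B‖ ≤ C := by
  have hp2 : p ≠ 2 := (ne_two_and_legendreSym_neg_one_of_mod_four_eq_one (p := p) hp4).1
  obtain ⟨c, hrel⟩ := exists_legendreTwistPlusRel_of_twist hp4 V W hVW hadd hf hg
  obtain ⟨hap1, hpN⟩ := LFunction_eq_or_eq_neg_and_dvd_level_of_mult V hV hg
  exact exists_isTameBranchOf_legendre_of_mult hp2 hg.1 hg.coeffField_eq_bot hpN (hg.2 p) hap1 hrel

/-- **(M): `∃!`** — the branch of `exists_isTameBranchOf_of_mult_twist` is THE tame branch for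
`(f_E, χ_p, a_p(E♭))` (`IsTameBranchOf.unique`). [cite: MazurTateTeitelbaum1986Invent, §I.11 and §I.14 (14.3)] -/
theorem existsUnique_isTameBranchOf_of_mult_twist (hp4 : p % 4 = 1)
    (V W : WeierstrassCurve ℚ) [V.IsElliptic] [W.IsElliptic]
    (hVW : ∃ C : VariableChange ℚ, C • V.quadraticTwist (p : ℚ) = W) (hadd : Addv W p)
    (hV : Mult V p) (hf : IsNewformOf W f) (hg : IsNewformOf V g) :
    ∃! B : PowerSeries ℚ_[p],
      IsTameBranchOf f p ((legendreChar p).ringHomComp (algebraMap ℚ_[p] ℂ_[p]))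
        (((V.LFunction p : ℤ)) : ℚ_[p]) B := by
  obtain ⟨B, hB, -⟩ := exists_isTameBranchOf_of_mult_twist hp4 V W hVW hadd hV hf hg
  exact ⟨B, hB, fun B' hB' ↦ hB'.unique hB⟩

end Unconditional

/-! ### §4 JOIN: on these loci the ONLY non-theorem input of the Λ-level N10 statement is `TameBranchRatCharEqAt` -/

section Join

variable (W : WeierstrassCurve ℚ) [W.IsElliptic] [W.IsGloballyMinimal] (p : ℕ) [hp : Fact p.Prime]
  {N N' : ℕ} [NeZero N] [NeZero N'] {f : CuspForm (Gamma0 N) 2} {g : CuspForm (Gamma0 N') 2}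

/-- **JOIN on (M), `p ≡ 1 (mod 4)`.** For `E = W` globally minimal, additive at `p`, `ℚ`-isomorphic to
`V ⊗ χ_p` with `V` multiplicative at `p`, newforms `f` of `W` and `g` of `V`: GIVEN the typed rational
tame-branch main conjecture `TameBranchRatCharEqAt W p` (N10 missing input, NOT in print — an explicit
binder, nothing asserted), there is a (the) tame branch `B` for `(f, χ_p, a_p(V))` and every Selmer
dual datum of `E` over the cyclotomic `ℤ_p`-extension is `Λ`-torsion with characteristic power series
`p^k·B(T)`. All other inputs are THEOREMS (§1–§3; `PotMult W p` by §2). -/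
theorem exists_isTameBranchOf_and_charIdeal_eq_of_mult_twist (hT : TameBranchRatCharEqAt W p)
    (hp4 : p % 4 = 1) (V : WeierstrassCurve ℚ) [V.IsElliptic]
    (hVW : ∃ C : VariableChange ℚ, C • V.quadraticTwist (p : ℚ) = W) (hadd : Addv W p)
    (hV : Mult V p) {K : ZpExtension ℚ p} {γ : Field.absoluteGaloisGroup ℚ} (hK : K.IsCyclotomic)
    (hγ : K.IsTopGenerator γ) (hcyc : IsCyclotomicVariable p γ)
    (hf : IsNewformOf W f) (hg : IsNewformOf V g) :
    ∃ B : PowerSeries ℚ_[p],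
      IsTameBranchOf f p ((legendreChar p).ringHomComp (algebraMap ℚ_[p] ℂ_[p]))
        (((V.LFunction p : ℤ)) : ℚ_[p]) B ∧
      ∀ D : W.SelmerDualData K γ, D.IsTorsion ∧
        ∃ (G : IwasawaAlgebra p) (k : ℤ), D.charIdeal = Ideal.span {G} ∧
          iwasawaToPowerSeries p G = PowerSeries.C ((p : ℚ_[p]) ^ k) * B := by
  have hp2 : p ≠ 2 := (ne_two_and_legendreSym_neg_one_of_mod_four_eq_one (p := p) hp4).1
  obtain ⟨B, hB, -⟩ := exists_isTameBranchOf_of_mult_twist hp4 V W hVW hadd hV hf hg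
  obtain ⟨hap1, -⟩ := LFunction_eq_or_eq_neg_and_dvd_level_of_mult V hV hg
  have hαu : ‖(((V.LFunction p : ℤ)) : ℚ_[p])‖ = 1 := by
    rcases hap1 with h | h <;> rw [h] <;> simp
  have hM : PotMult W p :=
    potMult_of_twist_of_mult V W (by exact_mod_cast hp.out.ne_zero) hVW hV
  exact ⟨B, hB, fun D ↦ isTorsion_and_charIdeal_eq_of_tameBranchRatCharEq_legendre_of_potMult W p
    hT hp2 hadd hM hK hγ hcyc hf hαu hB D⟩

/-- **JOIN on (G-ord, `e = 2`), `p ≡ 1 (mod 4)`.** As above with `V` globally minimal GOOD ORDINARY at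
`p` and `α = unitRoot V p`; the `W`-side typing of the row (`PotMult W p ∨ TypeGOrd W p`,
`tameDefect W p = 2`: Kodaira `I₀*`) is taken as binders, `TameBranchRatCharEqAt W p` is the one
non-theorem input. Nothing asserted; nothing booked. -/
theorem exists_isTameBranchOf_and_charIdeal_eq_of_goodOrd_twist (hT : TameBranchRatCharEqAt W p)
    (hp4 : p % 4 = 1) (V : WeierstrassCurve ℚ) [V.IsElliptic] [V.IsGloballyMinimal]
    (hVW : ∃ C : VariableChange ℚ, C • V.quadraticTwist (p : ℚ) = W) (hadd : Addv W p)
    (hord : GoodOrd V p) (hloc : PotMult W p ∨ TypeGOrd W p) (he : tameDefect W p = 2)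
    {K : ZpExtension ℚ p} {γ : Field.absoluteGaloisGroup ℚ} (hK : K.IsCyclotomic)
    (hγ : K.IsTopGenerator γ) (hcyc : IsCyclotomicVariable p γ)
    (hf : IsNewformOf W f) (hg : IsNewformOf V g) :
    ∃ B : PowerSeries ℚ_[p],
      IsTameBranchOf f p ((legendreChar p).ringHomComp (algebraMap ℚ_[p] ℂ_[p]))
        (unitRoot V p : ℚ_[p]) B ∧
      ∀ D : W.SelmerDualData K γ, D.IsTorsion ∧
        ∃ (G : IwasawaAlgebra p) (k : ℤ), D.charIdeal = Ideal.span {G} ∧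
          iwasawaToPowerSeries p G = PowerSeries.C ((p : ℚ_[p]) ^ k) * B := by
  have hp2 : p ≠ 2 := (ne_two_and_legendreSym_neg_one_of_mod_four_eq_one (p := p) hp4).1
  obtain ⟨B, hB, -⟩ := exists_isTameBranchOf_of_goodOrd_twist hp4 V W hVW hadd hord hf hg
  obtain ⟨-, hαu, -⟩ := unitRoot_coe_spec (W := V) ((isOrdinaryAt_iff V p).mpr hord)
  exact ⟨B, hB, fun D ↦ isTorsion_and_charIdeal_eq_of_tameBranchRatCharEq_legendre W p hT hp2 hadd
    hloc he hK hγ hcyc hf hαu hB D⟩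

end Join

end Summit.BirchSwinnertonDyer.Rank1Residual.Additive

end
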